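import Literature.Topology.FourManifolds.PLManifold
import Mathlib.Analysis.Normed.Affine.AddTorsor
import Mathlib.Analysis.Normed.Affine.AddTorsorBases
import HarnessLib

/-!
# Proofs for `PLManifold.lean`: discharges of the elementary PL-map facts

Sibling proof file of `Literature/Topology/FourManifolds/PLManifold.lean` (D-0014: a named fact
`def X : Prop` is discharged by `theorem X_holds : X`).

* `Literature.Topology.FourManifolds.isPLOn_affineMap_holds`: the named fact
  `isPLOn_affineMap` — *an affine map `ℝⁿ →ᵃ[ℝ] ℝᵐ` is PL on all of `ℝⁿ`* — holds. As in
  Rourke–Sanderson, Ch. 1 (first example of a PL map): every point `a ∈ ℝⁿ` lies in the interior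
  of an `n`-simplex `σ`, and `σ` together with all its faces is a finite simplicial complex on each
  of whose simplices the affine map is (trivially) affine.

* `Literature.Topology.FourManifolds.IsPLOn.mono_holds`: the named fact `IsPLOn.mono` —
  *if `f` is PL on `u` and `v ⊆ u` is open then `f` is PL on `v`* — holds
  (Rourke–Sanderson 2.11–2.12 do this by subdivision; here the local finite complex at `a` is
  replaced by the closed star of `a`, shrunk into `v` by a homothety about `a` of small ratio,
  which maps every simplex containing `a` into itself).

The geometric input is isolated as `exists_affineIndependent_convexHull_mem_nhds` (every point of
a finite-dimensional real normed space is interior to some simplex: translate the simplex spanned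
by an affine basis so that its centroid moves to the point),
`exists_simplicialComplex_faces_iff_subset` (the complex of all faces of one simplex, via
Mathlib's `Geometry.SimplicialComplex.ofErase` and `AffineIndependent.convexHull_inter`),
`exists_simplicialComplex_faces_eq_of_subset` (subcomplexes),
`exists_simplicialComplex_faces_iff_image` (image of a complex under an affine equivalence),
`biUnion_convexHull_mem_nhds` (the closed star of `a` in a finite complex neighbourhood of `a` is
a neighbourhood of `a`) and the shrinking lemma
`exists_simplicialComplex_space_subset_of_mem_nhds`.
Everything here is a `theorem` (no new definitions or named facts); complexes are produced by
existence statements describing their faces.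
-/

open scoped Topology
open Set Function

noncomputable section

namespace Literature.Topology.FourManifolds

open _root_.Topology

section Simplex

variable {E : Type*} [NormedAddCommGroup E] [NormedSpace ℝ E]

/-- The simplicial complex consisting of one simplex and all its faces exists: for an affinely
independent finite set `S` there is a simplicial complex whose faces are exactly the nonempty
subsets of `S`. (Two faces of a simplex meet in their common face, Mathlib's
`AffineIndependent.convexHull_inter`; built with `Geometry.SimplicialComplex.ofErase`.)
Rourke–Sanderson (1972), Ch. 2 (a simplex with its faces is a simplicial complex). [folklore] -/
theorem exists_simplicialComplex_faces_iff_subset (S : Finset E)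
    (hS : AffineIndependent ℝ ((↑) : S → E)) :
    ∃ K : Geometry.SimplicialComplex ℝ E, ∀ t, t ∈ K.faces ↔ t ⊆ S ∧ t ≠ ∅ :=
  ⟨Geometry.SimplicialComplex.ofErase {t | t ⊆ S}
    (fun _ ht => hS.mono ht)
    (fun _ _ hut ht => hut.trans ht)
    (fun _ ht _ hu => (hS.convexHull_inter ht hu).symm.subset), fun t => by simp⟩

/-- A simplicial complex whose faces are the nonempty subsets of a finite set `S` is finite.
[folklore] -/
theorem faces_finite_of_faces_iff_subset {S : Finset E} {K : Geometry.SimplicialComplex ℝ E}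
    (hK : ∀ t, t ∈ K.faces ↔ t ⊆ S ∧ t ≠ ∅) : K.faces.Finite :=
  S.powerset.finite_toSet.subset fun t ht => by simpa using ((hK t).1 ht).1

/-- The underlying space of the complex of all faces of the simplex on `S` is the closed simplex
`convexHull ℝ S`. [folklore] -/
theorem space_eq_convexHull_of_faces_iff_subset {S : Finset E}
    {K : Geometry.SimplicialComplex ℝ E} (hK : ∀ t, t ∈ K.faces ↔ t ⊆ S ∧ t ≠ ∅) (hne : S ≠ ∅) :
    K.space = convexHull ℝ (S : Set E) := by
  refine Subset.antisymm ?_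
    (Geometry.SimplicialComplex.convexHull_subset_space ((hK S).2 ⟨Finset.Subset.refl S, hne⟩))
  intro x hx
  obtain ⟨t, ht, hxt⟩ := Geometry.SimplicialComplex.mem_space_iff.1 hx
  exact convexHull_mono (by exact_mod_cast ((hK t).1 ht).1) hxt

variable [FiniteDimensional ℝ E]

/-- Every point `a` of a finite-dimensional real normed space lies in the interior of some
simplex: there is an affinely independent finite set `S` with `convexHull ℝ S ∈ 𝓝 a`
(translate the simplex on an affine basis so that its centroid becomes `a`). [folklore] -/
theorem exists_affineIndependent_convexHull_mem_nhds (a : E) :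
    ∃ S : Finset E, AffineIndependent ℝ ((↑) : S → E) ∧ convexHull ℝ (S : Set E) ∈ 𝓝 a := by
  classical
  obtain ⟨s, b, hb⟩ := AffineBasis.exists_affineBasis ℝ E E
  lift s to Finset E using b.finite_set
  have hc : Finset.univ.centroid ℝ b ∈ interior (convexHull ℝ (Set.range b)) :=
    b.centroid_mem_interior_convexHull
  set c : E := Finset.univ.centroid ℝ b with hc_def
  rw [hb, Subtype.range_coe] at hc
  -- translate by `a - c`
  let e : E ≃ᵃ[ℝ] E := AffineEquiv.constVAdd ℝ E (a - c)
  have hind : AffineIndependent ℝ ((↑) : ↥(e '' (s : Set E)) → E) :=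
    (e.affineIndependent_set_of_eq_iff).2 (by rw [← hb]; exact b.ind)
  have hT : ((s.image e : Finset E) : Set E) = e '' (s : Set E) := Finset.coe_image
  refine ⟨s.image e, ?_, ?_⟩
  · rw [← hT] at hind
    exact hind
  · rw [hT, ← AffineEquiv.coe_toAffineMap, ← AffineMap.image_convexHull]
    have himg : (e.toAffineMap : E → E) '' convexHull ℝ (s : Set E) =
        (Homeomorph.addLeft (a - c)) '' convexHull ℝ (s : Set E) := by
      congr 1
    rw [himg]
    have key := (Homeomorph.addLeft (a - c)).isOpenMap.image_mem_nhds
      (mem_interior_iff_mem_nhds.1 hc)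
    simpa [sub_add_cancel] using key


omit [FiniteDimensional ℝ E] in
/-- Images of convex hulls under an affine equivalence (Mathlib's `AffineMap.image_convexHull`
restated for the coercion of an `AffineEquiv`). [folklore] -/
theorem image_convexHull_affineEquiv (e : E ≃ᵃ[ℝ] E) (s : Set E) :
    e '' convexHull ℝ s = convexHull ℝ (e '' s) :=
  (e : E →ᵃ[ℝ] E).image_convexHull s

omit [FiniteDimensional ℝ E] in
/-- A subcomplex: any family of faces of a simplicial complex `K` which is closed under passing
to nonempty subsets is the set of faces of a simplicial complex.
Rourke–Sanderson (1972), Ch. 2 (subcomplexes). [folklore] -/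
theorem exists_simplicialComplex_faces_eq_of_subset (K : Geometry.SimplicialComplex ℝ E)
    (F : Set (Finset E)) (hF : F ⊆ K.faces)
    (hdown : ∀ s ∈ F, ∀ t ⊆ s, t.Nonempty → t ∈ F) :
    ∃ K' : Geometry.SimplicialComplex ℝ E, K'.faces = F :=
  ⟨{ faces := F
     indep := fun hs => K.indep (hF hs)
     isRelLowerSet_faces := fun s hs =>
       ⟨K.nonempty_of_mem_faces (hF hs), fun t hts htn => hdown s hs t hts htn⟩
     inter_subset_convexHull := fun hs ht => K.inter_subset_convexHull (hF hs) (hF ht) }, rfl⟩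

omit [FiniteDimensional ℝ E] in
/-- The image of a simplicial complex under an affine equivalence is a simplicial complex, with
faces the images of the faces. Rourke–Sanderson (1972), Ch. 2. [folklore] -/
theorem exists_simplicialComplex_faces_iff_image (K : Geometry.SimplicialComplex ℝ E)
    (e : E ≃ᵃ[ℝ] E) [DecidableEq E] :
    ∃ K' : Geometry.SimplicialComplex ℝ E, ∀ t, t ∈ K'.faces ↔ ∃ s ∈ K.faces, s.image e = t := by
  refine ⟨{ faces := {t | ∃ s ∈ K.faces, s.image e = t}
            indep := ?_
            isRelLowerSet_faces := ?_
            inter_subset_convexHull := ?_ }, fun t => Iff.rfl⟩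
  · rintro _ ⟨s, hs, rfl⟩
    refine ⟨(K.nonempty_of_mem_faces hs).image e, ?_⟩
    intro t' ht' ht'ne
    obtain ⟨s', hs's, rfl⟩ := Finset.subset_image_iff.1 ht'
    exact ⟨s', K.down_closed hs hs's (Finset.image_nonempty.1 ht'ne), rfl⟩
  · rintro _ ⟨s, hs, rfl⟩
    have h := (e.affineIndependent_set_of_eq_iff (s := (s : Set E))).2 (K.indep hs)
    rw [← Finset.coe_image] at h
    exact h
  · rintro _ _ ⟨s, hs, rfl⟩ ⟨t, ht, rfl⟩
    rw [Finset.coe_image, Finset.coe_image, ← Set.image_inter e.injective,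
      ← image_convexHull_affineEquiv, ← image_convexHull_affineEquiv,
      ← image_convexHull_affineEquiv, ← Set.image_inter e.injective]
    exact Set.image_mono (K.inter_subset_convexHull hs ht)

omit [FiniteDimensional ℝ E] in
/-- The underlying space of the image complex is the image of the underlying space. [folklore] -/
theorem space_eq_image_of_faces_iff_image {K K' : Geometry.SimplicialComplex ℝ E}
    {e : E ≃ᵃ[ℝ] E} [DecidableEq E]
    (hK' : ∀ t, t ∈ K'.faces ↔ ∃ s ∈ K.faces, s.image e = t) : K'.space = e '' K.space := by
  ext x
  simp only [Geometry.SimplicialComplex.mem_space_iff, Set.mem_image]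
  constructor
  · rintro ⟨t, ht, hxt⟩
    obtain ⟨s, hs, rfl⟩ := (hK' t).1 ht
    rw [Finset.coe_image, ← image_convexHull_affineEquiv] at hxt
    obtain ⟨y, hy, rfl⟩ := hxt
    exact ⟨y, ⟨s, hs, hy⟩, rfl⟩
  · rintro ⟨y, ⟨s, hs, hy⟩, rfl⟩
    refine ⟨s.image e, (hK' _).2 ⟨s, hs, rfl⟩, ?_⟩
    rw [Finset.coe_image, ← image_convexHull_affineEquiv]
    exact Set.mem_image_of_mem _ hy

omit [FiniteDimensional ℝ E] in
/-- In a *finite* simplicial complex whose underlying space is a neighbourhood of `a`, the union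
of the closed simplices containing `a` (the closed star of the carrier of `a`) is already a
neighbourhood of `a`: the finitely many closed simplices missing `a` form a closed set avoiding
`a`. Rourke–Sanderson (1972), Ch. 2 (stars). [folklore] -/
theorem biUnion_convexHull_mem_nhds {K : Geometry.SimplicialComplex ℝ E} (hfin : K.faces.Finite)
    {a : E} (ha : K.space ∈ 𝓝 a) :
    (⋃ t ∈ {t ∈ K.faces | a ∈ convexHull ℝ (t : Set E)}, convexHull ℝ (t : Set E)) ∈ 𝓝 a := by
  set C : Set E := ⋃ t ∈ {t ∈ K.faces | a ∉ convexHull ℝ (t : Set E)}, convexHull ℝ (t : Set E)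
    with hC
  have hCclosed : IsClosed C :=
    (hfin.subset (Set.sep_subset _ _)).isClosed_biUnion fun t _ =>
      t.finite_toSet.isClosed_convexHull ℝ
  have haC : a ∉ C := by
    simp only [hC, Set.mem_iUnion, Set.mem_sep_iff, exists_prop, not_exists, not_and, and_imp]
    exact fun t _ hat hat' => hat hat'
  filter_upwards [ha, hCclosed.isOpen_compl.mem_nhds haC] with x hx hxC
  obtain ⟨t, ht, hxt⟩ := Geometry.SimplicialComplex.mem_space_iff.1 hx
  by_cases hat : a ∈ convexHull ℝ (t : Set E)
  · exact Set.mem_biUnion (x := t) ⟨ht, hat⟩ hxt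
  · exact (hxC (Set.mem_biUnion (x := t) ⟨ht, hat⟩ hxt)).elim

omit [FiniteDimensional ℝ E] in
/-- **Shrinking lemma for finite complexes.** If `f` agrees with an affine map on each simplex
of a finite simplicial complex `K` whose underlying space is a neighbourhood of `a`, then for
every neighbourhood `v` of `a` there is a finite simplicial complex `K'` with `K'.space` a
neighbourhood of `a` contained in `v`, on each of whose simplices `f` again agrees with an affine
map: take the closed star of `a` in `K` and shrink it towards `a` by a homothety of small ratio
`c ∈ (0, 1]` (each simplex `σ ∋ a` is mapped into itself). This is the elementary substitute for
subdivision used to restrict PL maps. Rourke–Sanderson (1972), 2.11–2.12. [folklore] -/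
theorem exists_simplicialComplex_space_subset_of_mem_nhds {F : Type*}
    {K : Geometry.SimplicialComplex ℝ E} (hfin : K.faces.Finite) {a : E} (ha : K.space ∈ 𝓝 a)
    {f : E → F} {G : Set (E → F)}
    (hK : ∀ s ∈ K.faces, ∃ g ∈ G, EqOn f g (convexHull ℝ (s : Set E)))
    {v : Set E} (hv : v ∈ 𝓝 a) :
    ∃ K' : Geometry.SimplicialComplex ℝ E, K'.faces.Finite ∧ K'.space ∈ 𝓝 a ∧ K'.space ⊆ v ∧
      ∀ s ∈ K'.faces, ∃ g ∈ G, EqOn f g (convexHull ℝ (s : Set E)) := by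
  classical
  -- the closed star of `a`
  set StF : Set (Finset E) :=
    {s ∈ K.faces | ∃ t ∈ K.faces, s ⊆ t ∧ a ∈ convexHull ℝ (t : Set E)} with hStF
  obtain ⟨K₁, hK₁⟩ := exists_simplicialComplex_faces_eq_of_subset K StF (Set.sep_subset _ _)
    (fun s hs t hts htn => ⟨K.down_closed hs.1 hts htn,
      hs.2.imp fun u hu => ⟨hu.1, hts.trans hu.2.1, hu.2.2⟩⟩)
  -- the union `A` of the simplices containing `a`
  set A : Set E := ⋃ t ∈ {t ∈ K.faces | a ∈ convexHull ℝ (t : Set E)}, convexHull ℝ (t : Set E)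
    with hA
  have hA_nhds : A ∈ 𝓝 a := biUnion_convexHull_mem_nhds hfin ha
  have hA_sub : A ⊆ K₁.space := by
    intro x hx
    simp only [hA, Set.mem_iUnion, Set.mem_sep_iff, exists_prop] at hx
    obtain ⟨t, ⟨ht, hat⟩, hxt⟩ := hx
    exact Geometry.SimplicialComplex.mem_space_iff.2
      ⟨t, hK₁ ▸ ⟨ht, t, ht, Finset.Subset.refl t, hat⟩, hxt⟩
  have hK₁_sub : K₁.space ⊆ A := by
    intro x hx
    obtain ⟨s, hs, hxs⟩ := Geometry.SimplicialComplex.mem_space_iff.1 hx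
    rw [hK₁] at hs
    obtain ⟨t, ht, hst, hat⟩ := hs.2
    simp only [hA, Set.mem_iUnion, Set.mem_sep_iff, exists_prop]
    exact ⟨t, ⟨ht, hat⟩, convexHull_mono (by exact_mod_cast hst) hxs⟩
  have hA_bdd : Bornology.IsBounded A :=
    (Bornology.isBounded_biUnion (hfin.subset (Set.sep_subset _ _))).2 fun t _ =>
      (t.finite_toSet.isCompact_convexHull ℝ).isBounded
  -- radii: `A ⊆ ball a R`, `ball a ε ⊆ v`, ratio `c`
  obtain ⟨R, hR0, hAR⟩ := hA_bdd.subset_ball_lt 0 a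
  obtain ⟨ε, hε0, hεv⟩ := Metric.mem_nhds_iff.1 hv
  set c : ℝ := min 1 (ε / (2 * R)) with hc
  have hc0 : 0 < c := lt_min one_pos (by positivity)
  have hc1 : c ≤ 1 := min_le_left _ _
  have hcR : c * R < ε := by
    calc c * R ≤ ε / (2 * R) * R := by gcongr; exact min_le_right _ _
      _ = ε / 2 := by field_simp
      _ < ε := by linarith
  -- the homothety of ratio `c` about `a`, as an affine equivalence
  set e : E ≃ᵃ[ℝ] E := AffineEquiv.homothetyUnitsMulHom a (Units.mk0 c hc0.ne') with he
  have he_apply : ∀ x, e x = AffineMap.homothety a c x := fun x => by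
    simp [he, AffineEquiv.coe_homothetyUnitsMulHom_apply]
  obtain ⟨K₂, hK₂⟩ := exists_simplicialComplex_faces_iff_image K₁ e
  have hK₂space : K₂.space = e '' K₁.space := space_eq_image_of_faces_iff_image hK₂
  refine ⟨K₂, ?_, ?_, ?_, ?_⟩
  · -- finiteness
    refine ((hfin.subset (Set.sep_subset _ _ : StF ⊆ K.faces)).image (Finset.image e)).subset ?_
    intro t ht
    obtain ⟨s, hs, rfl⟩ := (hK₂ t).1 ht
    rw [hK₁] at hs
    exact Set.mem_image_of_mem _ hs
  · -- neighbourhood of `a`: `e '' K₁.space = e.symm ⁻¹' K₁.space`, `e.symm` continuous, fixes `a`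
    rw [hK₂space, ← AffineEquiv.preimage_symm]
    refine ContinuousAt.preimage_mem_nhds ?_ ?_
    · rw [he, AffineEquiv.coe_homothetyUnitsMulHom_apply_symm]
      exact (AffineMap.homothety_continuous _ _).continuousAt
    · rw [he, AffineEquiv.coe_homothetyUnitsMulHom_apply_symm, AffineMap.homothety_apply_same]
      exact Filter.mem_of_superset hA_nhds hA_sub
  · -- contained in `v`
    rw [hK₂space]
    rintro _ ⟨y, hy, rfl⟩
    refine hεv ?_
    have hyR : dist a y < R := by rw [dist_comm]; exact hAR (hK₁_sub hy)
    rw [Metric.mem_ball, he_apply, dist_homothety_center, Real.norm_eq_abs, abs_of_pos hc0]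
    calc c * dist a y ≤ c * R := by gcongr
      _ < ε := hcR
  · -- affine pieces
    intro t ht
    obtain ⟨s, hs, rfl⟩ := (hK₂ t).1 ht
    rw [hK₁] at hs
    obtain ⟨u, hu, hsu, hau⟩ := hs.2
    obtain ⟨g, hg, hfg⟩ := hK u hu
    refine ⟨g, hg, fun x hx => hfg ?_⟩
    rw [Finset.coe_image, ← image_convexHull_affineEquiv] at hx
    obtain ⟨y, hy, rfl⟩ := hx
    rw [he_apply, AffineMap.homothety_eq_lineMap]
    exact (convex_convexHull ℝ _).lineMap_mem hau (convexHull_mono (by exact_mod_cast hsu) hy)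
      ⟨hc0.le, hc1⟩

end Simplex

section PLMaps

variable {n m : ℕ}

/-- **Discharge of `isPLOn_affineMap`.** An affine map `g : ℝⁿ →ᵃ[ℝ] ℝᵐ` is PL on all of `ℝⁿ`:
around any point `a` take a simplex containing `a` in its interior
(`exists_affineIndependent_convexHull_mem_nhds`); with its faces it is a finite simplicial
complex (`exists_simplicialComplex_faces_iff_subset`) whose underlying space is a neighbourhood
of `a`, and on each of its simplices `g` agrees with the affine map `g` itself.
Rourke–Sanderson (1972), Ch. 1, Example (linear maps are PL). [cite: RourkeSanderson1972] -/
theorem isPLOn_affineMap_holds : isPLOn_affineMap (n := n) (m := m) := by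
  intro g a _
  obtain ⟨S, hS, hnhds⟩ := exists_affineIndependent_convexHull_mem_nhds a
  have hne : S ≠ ∅ := by
    rintro rfl
    have : a ∈ convexHull ℝ ((∅ : Finset (EuclideanSpace ℝ (Fin n))) :
        Set (EuclideanSpace ℝ (Fin n))) := mem_of_mem_nhds hnhds
    simp at this
  obtain ⟨K, hK⟩ := exists_simplicialComplex_faces_iff_subset S hS
  refine ⟨K, faces_finite_of_faces_iff_subset hK, ?_, subset_univ _, fun s _ => ⟨g, fun x _ => rfl⟩⟩
  rw [space_eq_convexHull_of_faces_iff_subset hK hne]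
  exact hnhds


/-- **Discharge of `IsPLOn.mono`.** The restriction of a PL map to an open subset is PL: if `f`
is PL on `u` and `v ⊆ u` is open, then around `a ∈ v` the local finite complex for `f` on `u`
is replaced by the shrunken closed star of `a`
(`exists_simplicialComplex_space_subset_of_mem_nhds`), which lies in `v`.
Rourke–Sanderson (1972), 2.11–2.12. [cite: RourkeSanderson1972] -/
theorem IsPLOn.mono_holds : IsPLOn.mono (n := n) (m := m) := by
  intro f u v hf hv hvu a hav
  obtain ⟨K, hfin, hKa, -, hK⟩ := hf a (hvu hav)
  obtain ⟨K', hfin', hK'a, hK'v, hK'⟩ :=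
    exists_simplicialComplex_space_subset_of_mem_nhds hfin hKa
      (G := Set.range fun g : EuclideanSpace ℝ (Fin n) →ᵃ[ℝ] EuclideanSpace ℝ (Fin m) => ⇑g)
      (fun s hs => by
        obtain ⟨g, hg⟩ := hK s hs
        exact ⟨g, ⟨g, rfl⟩, hg⟩)
      (hv.mem_nhds hav)
  refine ⟨K', hfin', hK'a, hK'v, fun s hs => ?_⟩
  obtain ⟨_, ⟨g, rfl⟩, hfg⟩ := hK' s hs
  exact ⟨g, hfg⟩

end PLMaps

end Literature.Topology.FourManifolds
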